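/-
Copyright (c) 2026 the pub-hodgecm-mathlib formalisation cell (harness21).  Prover seat hodgecm-mathlib-K2E3-p12 (g5) (E3 §L lead on loan to E1), Track B ∕ K2-LIT,
h413 = `stmt-HodgeConjecture-24833`, line `K2_E1_TraceFormulaBeta`, campaign «EIS-WHITTAKER-2» rung W2-arch (dealer K2E1-plan (g4) 2026-09-04T06:58:37Z ∕ 06:58:54Z):
THE ARCHIMEDEAN WHITTAKER TRANSFORM OF THE SPHERICAL SYMBOL `(1 + c s²)^{−z}` — GAMMA TRICK, GAUSSIAN FIBRE, FUBINI, AND ITS ENTIRE CONTINUATION IN `z`.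
-/
import Summits.HodgeConjecture.HodgeConjecture.Theorems.K2E1OnePlusSqPowerSymbol   -- ★ p857934 (D5-a1): the symbol `(((1 + c*s^2 : ℝ)) : ℂ) ^ (−z)`, `norm_onePlusSqPow`
import Mathlib.Analysis.SpecialFunctions.Gamma.Beta
import Mathlib.Analysis.SpecialFunctions.Gaussian.FourierTransform
import Mathlib.Analysis.MellinTransform
import Mathlib.MeasureTheory.Integral.Prod
import HarnessLib

/-!
# K2·E1 — `K2E1ArchWhittakerContinuation`: `∫_ℝ (1 + c s²)^{−z} e^{−2πiξs} ds = Γ(z)⁻¹·√(π∕c)·∫_0^∞ t^{z−3∕2} e^{−t−π²ξ²∕(ct)} dt` AND ITS CONTINUATION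

Track B ∕ K2-LIT, crux h413 = `stmt-HodgeConjecture-24833`, route of record `HCCMUnconditional`; cell `hodgecm-mathlib`, squad K2, ENGINE E1 (campaign «EIS-WHITTAKER-2»,
rung W2-arch — the crux of the campaign).  Prover seat `hodgecm-mathlib-K2E3-p12` (g5) on loan.  THEOREMS ONLY (no `def`, no `instance`, no notation, no named-fact
hypothesis, no `sorry`); lane `--supports stmt-HodgeConjecture-24833 --as helper` (count-neutral).  Closes no socket.

THE MATHEMATICS [Bump1997, §1.6 (1.24)–(1.27), §3.7; Garrett2018, §1.9–§1.10; MoeglinWaldspurger1995, I.2.10].  At a real place the spherical section of the induced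
representation of `U(1,1) ≅ SL₂`-type rank one restricted to the big cell is the symbol `s ↦ (1 + c s²)^{−z}` (★ (D5-a1)); its Fourier transform in `s` is the archimedean
Whittaker function of the Eisenstein series.  Hecke's GAMMA TRICK `(1 + c s²)^{−z}·Γ(z) = ∫_0^∞ t^{z−1} e^{−t(1 + c s²)} dt` (`Re z > 0`) turns the symbol into a Gaussian in
`s`; the GAUSSIAN FIBRE `∫_ℝ e^{−tcs² − 2πiξs} ds = √(π∕(tc))·e^{−π²ξ²∕(tc)}` and FUBINI on `(0,∞) × ℝ` (absolutely convergent iff `Re z > ½`: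
`∫∫|·| = √(π∕c)·Γ(Re z − ½)`) give
  **`∫_ℝ (1 + c s²)^{−z} e^{−2πiξs} ds = Γ(z)⁻¹ · √(π∕c) · ∫_0^∞ t^{z−3∕2} e^{−t − π²ξ²∕(ct)} dt`**   (`Re z > ½`, `c > 0`, `ξ ∈ ℝ`)
— the right side is `Γ(z)⁻¹·√(π∕c)·𝓜[e^{−t−A∕t}](z − ½)`, `A = π²ξ²∕c` (a `K_{z−½}`-Bessel function, never named).  For `ξ ≠ 0` (`A > 0`) the kernel `e^{−t−A∕t}`
decays like `e^{−t}` at `∞` and faster than every power at `0⁺`, so its Mellin transform is ENTIRE (Mathlib `mellin_differentiableAt_of_isBigO_rpow_exp`): the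
Whittaker coefficient, a priori defined for `Re z > ½` only, CONTINUES to all `z ∈ ℂ` (times the entire `Γ(z)⁻¹`), and on vertical strips `½ < x₀ ≤ Re z ≤ x₁` it is
bounded by `C(x₀,x₁)·e^{−√A}` = `C·e^{−π|ξ|∕√c}` (from `t∕2 + A∕t ≥ √A`… precisely `t + A∕t ≥ t∕4 + √A`-type splitting: `e^{−t−A∕t} ≤ e^{−√A}·e^{−3t∕4}`) — the exponential
decay in `ξ` that rung W4 sums against divisor growth.
* §1 `onePlusSqPow_mul_Gamma_eq_integral` — the Gamma trick at the symbol (Mathlib `Complex.integral_cpow_mul_exp_neg_mul_Ioi`).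
* §2 `integral_gaussian_phase` — the Gaussian fibre with the phase inside (Mathlib `integral_cexp_quadratic`).
* §3 `integrable_gammaTrickKernel` (Tonelli on `(0,∞) × ℝ`, `Re z > ½`) and **`integral_onePlusSqPow_mul_phase_eq`** — the displayed formula.
* §4 **`differentiable_mellin_exp_neg_sub_div`** — `z ↦ 𝓜[e^{−t−A∕t}](z)` is entire for `A > 0`.
* §5 **`norm_mellin_exp_neg_sub_div_le`** — the strip bound `‖𝓜[e^{−t−A∕t}](z − ½)‖ ≤ C(x₀,x₁)·e^{−√A}` for `½ < x₀ ≤ Re z ≤ x₁`.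
SAT-WITNESS (ruling «VAC-U» (3)): no structure is quantified; `c > 0`, `ξ`, `z` free; at `z = 1`, `ξ = 0` §3 reads `∫ (1+cs²)⁻¹ ds = π∕√c` ✓.
HONEST LABEL: HC_CM is proved only modulo the 7 printed citations (2 remaining named inputs: hLiu418 = `stmt-HodgeConjecture-24832`, h413 = `stmt-HodgeConjecture-24833`)
until rung 0 closes; this file asserts no named fact and closes no socket.
References: [Bump1997] D. Bump, *Automorphic Forms and Representations*, §1.6, §3.7 · [Garrett2018] §1.9–§1.10 · [MoeglinWaldspurger1995] I.2.10.
-/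

set_option autoImplicit false
-- the mandated namespace repeats the single-problem summit's segment (`HodgeConjecture.HodgeConjecture`)
set_option linter.dupNamespace false

noncomputable section

open MeasureTheory Filter Topology Set Real Asymptotics
open scoped NNReal ENNReal
open Summit.HodgeConjecture.HodgeConjecture.Cruxes.H413.K2E1OnePlusSqPowerSymbol (onePlusSq_pos norm_onePlusSqPow)

namespace Summit.HodgeConjecture.HodgeConjecture.Cruxes.H413.K2E1ArchWhittakerContinuation

/-! ## §1  The Gamma trick at the symbol -/

/-- **HECKE'S GAMMA TRICK**: `(1 + c s²)^{−z} · Γ(z) = ∫_0^∞ t^{z−1} e^{−(1 + c s²)t} dt` for `Re z > 0`, `c ≥ 0` (Euler's integral rescaled by `r = 1 + cs² > 0`;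
Mathlib `Complex.integral_cpow_mul_exp_neg_mul_Ioi`, `(1∕r)^z = r^{−z}` for the positive real `r`). [cite: Bump1997, §1.6 (1.24)] -/
theorem onePlusSqPow_mul_Gamma_eq_integral {z : ℂ} (hz : 0 < z.re) {c : ℝ} (hc : 0 ≤ c) (s : ℝ) :
    (((1 + c * s ^ 2 : ℝ)) : ℂ) ^ (-z) * Complex.Gamma z =
      ∫ t in Ioi (0 : ℝ), (t : ℂ) ^ (z - 1) * Complex.exp (-(((1 + c * s ^ 2 : ℝ) : ℂ) * (t : ℂ))) := by
  have hr := onePlusSq_pos hc s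
  rw [Complex.integral_cpow_mul_exp_neg_mul_Ioi hz hr, one_div,
    Complex.inv_cpow _ _ (by rw [Complex.arg_ofReal_of_nonneg hr.le]; exact Real.pi_ne_zero.symm), Complex.cpow_neg]

/-! ## §2  The Gaussian fibre with the phase inside -/

/-- **THE GAUSSIAN FIBRE**: `∫_ℝ e^{−tc·s² − 2πiξs} ds = √(π∕(tc)) · e^{−π²ξ²∕(tc)}` for `t, c > 0`, `ξ ∈ ℝ` (complete the square; Mathlib `integral_cexp_quadratic` with
`b = −tc`, linear coefficient `−2πiξ`: `−(−2πiξ)²∕(4·(−tc)) = −π²ξ²∕(tc)`). [cite: Bump1997, §1.6 (1.26)] -/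
theorem integral_gaussian_phase {t c : ℝ} (ht : 0 < t) (hc : 0 < c) (ξ : ℝ) :
    ∫ s : ℝ, Complex.exp (-((t * c : ℝ) : ℂ) * (s : ℂ) ^ 2 - 2 * π * Complex.I * ξ * s) =
      ((Real.sqrt (π / (t * c)) : ℝ) : ℂ) * Complex.exp (-((π ^ 2 * ξ ^ 2 / (t * c) : ℝ) : ℂ)) := by
  have htc : 0 < t * c := mul_pos ht hc
  have hb : (-((t * c : ℝ) : ℂ)).re < 0 := by
    rw [Complex.neg_re, Complex.ofReal_re]; exact neg_neg_of_pos htc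
  have h := integral_cexp_quadratic hb (-(2 * π * Complex.I * ξ)) 0
  have hlhs : ∀ s : ℝ, -((t * c : ℝ) : ℂ) * (s : ℂ) ^ 2 - 2 * π * Complex.I * ξ * s =
      -((t * c : ℝ) : ℂ) * (s : ℂ) ^ 2 + -(2 * π * Complex.I * ξ) * s + 0 := fun s => by ring
  simp_rw [hlhs]
  rw [h]
  congr 1
  · rw [neg_neg, show (π : ℂ) / ((t * c : ℝ) : ℂ) = ((π / (t * c) : ℝ) : ℂ) by push_cast; rfl,
      show (1 / 2 : ℂ) = ((1 / 2 : ℝ) : ℂ) by push_cast; rfl, ← Complex.ofReal_cpow (by positivity), Real.sqrt_eq_rpow]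
  · congr 1
    have htc' : ((t * c : ℝ) : ℂ) ≠ 0 := by exact_mod_cast htc.ne'
    rw [zero_sub, neg_sq, show (2 * π * Complex.I * ξ : ℂ) ^ 2 = -(4 * π ^ 2 * ξ ^ 2) by
      rw [show (2 * π * Complex.I * ξ : ℂ) ^ 2 = (2 * π * ξ) ^ 2 * Complex.I ^ 2 by ring, Complex.I_sq]; ring]
    push_cast
    field_simp

/-! ## §3  Fubini: the Whittaker transform of the symbol -/

/-- The modulus of the Gamma-trick kernel: for `t > 0`,
`‖t^{z−1}·e^{−(1+cs²)t}·e^{−2πiξs}‖ = t^{Re z−1}·e^{−t}·e^{−tc·s²}`. [folklore] -/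
theorem norm_gammaTrickKernel {t : ℝ} (ht : 0 < t) (z : ℂ) (c ξ s : ℝ) :
    ‖(t : ℂ) ^ (z - 1) * Complex.exp (-(((1 + c * s ^ 2 : ℝ) : ℂ) * (t : ℂ))) * Complex.exp (-(2 * π * Complex.I * ξ * s))‖ =
      t ^ (z.re - 1) * Real.exp (-t) * Real.exp (-(t * c) * s ^ 2) := by
  rw [norm_mul, norm_mul, Complex.norm_cpow_eq_rpow_re_of_pos ht, Complex.norm_exp, Complex.norm_exp]
  have h1 : (-(((1 + c * s ^ 2 : ℝ) : ℂ) * (t : ℂ))).re = -t + -(t * c) * s ^ 2 := by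
    rw [← Complex.ofReal_mul, ← Complex.ofReal_neg, Complex.ofReal_re]; ring
  have h2 : (-(2 * π * Complex.I * ξ * s : ℂ)).re = 0 := by simp
  rw [h1, h2, Real.exp_zero, mul_one, Real.exp_add, Complex.sub_re, Complex.one_re, mul_assoc]

/-- **TONELLI FOR THE GAMMA-TRICK KERNEL** (`Re z > ½`, `c > 0`): `(t,s) ↦ t^{z−1} e^{−(1+cs²)t} e^{−2πiξs}` is integrable on `(0,∞) × ℝ`: the `s`-sections are Gaussians,
and `∫_ℝ |·| ds = √(π∕c)·t^{Re z − 3∕2}·e^{−t}` is Euler-integrable on `(0,∞)` exactly when `Re z − ½ > 0`. [cite: Bump1997, §1.6] -/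
theorem integrable_gammaTrickKernel {z : ℂ} (hz : 1 / 2 < z.re) {c : ℝ} (hc : 0 < c) (ξ : ℝ) :
    Integrable (fun p : ℝ × ℝ => (p.1 : ℂ) ^ (z - 1) * Complex.exp (-(((1 + c * p.2 ^ 2 : ℝ) : ℂ) * (p.1 : ℂ))) *
      Complex.exp (-(2 * π * Complex.I * ξ * p.2))) ((volume.restrict (Ioi (0 : ℝ))).prod volume) := by
  have hmeas : AEStronglyMeasurable (fun p : ℝ × ℝ => (p.1 : ℂ) ^ (z - 1) * Complex.exp (-(((1 + c * p.2 ^ 2 : ℝ) : ℂ) * (p.1 : ℂ))) *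
      Complex.exp (-(2 * π * Complex.I * ξ * p.2))) ((volume.restrict (Ioi (0 : ℝ))).prod volume) := by
    refine Measurable.aestronglyMeasurable ?_
    refine ((Complex.measurable_ofReal.comp measurable_fst).pow_const _).mul ?_ |>.mul ?_
    · exact Complex.measurable_exp.comp (((Complex.measurable_ofReal.comp (by fun_prop)).mul (Complex.measurable_ofReal.comp measurable_fst)).neg)
    · exact Complex.measurable_exp.comp ((measurable_const.mul (Complex.measurable_ofReal.comp measurable_snd)).neg)
  refine (integrable_prod_iff hmeas).2 ⟨?_, ?_⟩
  · -- the `s`-sections are Gaussians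
    refine (ae_restrict_mem measurableSet_Ioi).mono fun t (ht : 0 < t) => ?_
    have hb : (-((t * c : ℝ) : ℂ)).re < 0 := by
      rw [Complex.neg_re, Complex.ofReal_re]; exact neg_neg_of_pos (mul_pos ht hc)
    have hpt : ∀ s : ℝ, (t : ℂ) ^ (z - 1) * Complex.exp (-(((1 + c * s ^ 2 : ℝ) : ℂ) * (t : ℂ))) * Complex.exp (-(2 * π * Complex.I * ξ * s)) =
        (t : ℂ) ^ (z - 1) * Complex.exp (-(t : ℂ)) * Complex.exp (-((t * c : ℝ) : ℂ) * (s : ℂ) ^ 2 + -(2 * π * Complex.I * ξ) * s + 0) := by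
      intro s
      rw [show -(((1 + c * s ^ 2 : ℝ) : ℂ) * (t : ℂ)) = -(t : ℂ) + -((t * c : ℝ) : ℂ) * (s : ℂ) ^ 2 by push_cast; ring, Complex.exp_add,
        show -((t * c : ℝ) : ℂ) * (s : ℂ) ^ 2 + -(2 * π * Complex.I * ξ) * s + 0 = -((t * c : ℝ) : ℂ) * (s : ℂ) ^ 2 + -(2 * π * Complex.I * ξ * s) by ring,
        Complex.exp_add (-((t * c : ℝ) : ℂ) * (s : ℂ) ^ 2)]
      ring
    simp_rw [hpt]
    exact (integrable_cexp_quadratic' hb _ _).const_mul _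
  · -- `t ↦ ∫ |·| ds = √(π/c) · t^{Re z − 3/2} e^{−t}` is integrable on `(0,∞)`
    have hG : IntegrableOn (fun t : ℝ => Real.sqrt (π / c) * (Real.exp (-t) * t ^ ((z.re - 1 / 2) - 1))) (Ioi 0) :=
      (Real.GammaIntegral_convergent (by linarith : 0 < z.re - 1 / 2)).const_mul _
    refine (hG.congr_fun (fun t (ht : 0 < t) => ?_) measurableSet_Ioi)
    simp only
    simp_rw [norm_gammaTrickKernel ht]
    rw [integral_const_mul, integral_gaussian (t * c)]
    have hsq : Real.sqrt (π / (t * c)) = Real.sqrt (π / c) * t ^ (-(1 / 2 : ℝ)) := by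
      rw [show π / (t * c) = (π / c) * t⁻¹ by field_simp, Real.sqrt_mul (by positivity), Real.sqrt_eq_rpow, Real.sqrt_eq_rpow,
        Real.inv_rpow ht.le, Real.rpow_neg ht.le]
    rw [hsq, show (z.re - 1 / 2 - 1 : ℝ) = (z.re - 1) + (-(1 / 2)) by ring, Real.rpow_add ht]
    ring

/-- **THE ARCHIMEDEAN WHITTAKER TRANSFORM OF THE SPHERICAL SYMBOL** (`Re z > ½`, `c > 0`, `ξ ∈ ℝ`):
`∫_ℝ (1 + c s²)^{−z} e^{−2πiξs} ds = Γ(z)⁻¹ · √(π∕c) · ∫_0^∞ t^{z−3∕2} e^{−t − π²ξ²∕(ct)} dt` — Gamma trick (§1), Gaussian fibre (§2), Fubini (§3 Tonelli);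
`Γ(z) ≠ 0`. The right side is `Γ(z)⁻¹·√(π∕c)·𝓜[e^{−t−A∕t}](z − ½)`, `A = π²ξ²∕c` (§4–§5). [cite: Bump1997, §1.6 (1.26)–(1.27)] [cite: Garrett2018, §1.10] -/
theorem integral_onePlusSqPow_mul_phase_eq {z : ℂ} (hz : 1 / 2 < z.re) {c : ℝ} (hc : 0 < c) (ξ : ℝ) :
    ∫ s : ℝ, (((1 + c * s ^ 2 : ℝ)) : ℂ) ^ (-z) * Complex.exp (-(2 * π * Complex.I * ξ * s)) =
      (Complex.Gamma z)⁻¹ * ((Real.sqrt (π / c) : ℝ) : ℂ) *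
        ∫ t in Ioi (0 : ℝ), (t : ℂ) ^ (z - 3 / 2) * Complex.exp (-(t : ℂ) - ((π ^ 2 * ξ ^ 2 / c : ℝ) : ℂ) / (t : ℂ)) := by
  have hz0 : 0 < z.re := by linarith
  have hΓ : Complex.Gamma z ≠ 0 := Complex.Gamma_ne_zero_of_re_pos hz0
  have hint := integrable_gammaTrickKernel hz hc ξ
  -- the two iterated integrals
  have h1 := integral_prod_symm _ hint
  have h2 := integral_prod _ hint
  -- inner `t`-integral: the Gamma trick
  have hinner_t : ∀ s : ℝ, ∫ t in Ioi (0 : ℝ), (t : ℂ) ^ (z - 1) * Complex.exp (-(((1 + c * s ^ 2 : ℝ) : ℂ) * (t : ℂ))) *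
      Complex.exp (-(2 * π * Complex.I * ξ * s)) =
      Complex.Gamma z * ((((1 + c * s ^ 2 : ℝ)) : ℂ) ^ (-z) * Complex.exp (-(2 * π * Complex.I * ξ * s))) := by
    intro s
    rw [integral_mul_const, ← onePlusSqPow_mul_Gamma_eq_integral hz0 hc.le s]
    ring
  -- inner `s`-integral: the Gaussian fibre
  have hinner_s : ∀ t : ℝ, 0 < t → ∫ s : ℝ, (t : ℂ) ^ (z - 1) * Complex.exp (-(((1 + c * s ^ 2 : ℝ) : ℂ) * (t : ℂ))) *
      Complex.exp (-(2 * π * Complex.I * ξ * s)) =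
      ((Real.sqrt (π / c) : ℝ) : ℂ) * ((t : ℂ) ^ (z - 3 / 2) * Complex.exp (-(t : ℂ) - ((π ^ 2 * ξ ^ 2 / c : ℝ) : ℂ) / (t : ℂ))) := by
    intro t ht
    have hpt : ∀ s : ℝ, (t : ℂ) ^ (z - 1) * Complex.exp (-(((1 + c * s ^ 2 : ℝ) : ℂ) * (t : ℂ))) * Complex.exp (-(2 * π * Complex.I * ξ * s)) =
        (t : ℂ) ^ (z - 1) * Complex.exp (-(t : ℂ)) * Complex.exp (-((t * c : ℝ) : ℂ) * (s : ℂ) ^ 2 - 2 * π * Complex.I * ξ * s) := by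
      intro s
      rw [show -(((1 + c * s ^ 2 : ℝ) : ℂ) * (t : ℂ)) = -(t : ℂ) + -((t * c : ℝ) : ℂ) * (s : ℂ) ^ 2 by push_cast; ring, Complex.exp_add,
        show -((t * c : ℝ) : ℂ) * (s : ℂ) ^ 2 - 2 * π * Complex.I * ξ * s = -((t * c : ℝ) : ℂ) * (s : ℂ) ^ 2 + -(2 * π * Complex.I * ξ * s) by ring,
        Complex.exp_add (-((t * c : ℝ) : ℂ) * (s : ℂ) ^ 2)]
      ring
    simp_rw [hpt]
    rw [integral_const_mul, integral_gaussian_phase ht hc ξ]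
    have ht0 : (t : ℂ) ≠ 0 := by exact_mod_cast ht.ne'
    have hsq : ((Real.sqrt (π / (t * c)) : ℝ) : ℂ) = ((Real.sqrt (π / c) : ℝ) : ℂ) * (t : ℂ) ^ (-(1 / 2 : ℂ)) := by
      rw [show π / (t * c) = (π / c) * t⁻¹ by field_simp, Real.sqrt_mul (by positivity), Real.sqrt_eq_rpow (t⁻¹), Real.inv_rpow ht.le,
        ← Real.rpow_neg ht.le, Complex.ofReal_mul, Complex.ofReal_cpow ht.le]
      push_cast
      ring_nf
    have hpow : (t : ℂ) ^ (z - 1) * (t : ℂ) ^ (-(1 / 2 : ℂ)) = (t : ℂ) ^ (z - 3 / 2) := by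
      rw [← Complex.cpow_add _ _ ht0]; ring_nf
    have hexp : Complex.exp (-(t : ℂ)) * Complex.exp (-((π ^ 2 * ξ ^ 2 / (t * c) : ℝ) : ℂ)) =
        Complex.exp (-(t : ℂ) - ((π ^ 2 * ξ ^ 2 / c : ℝ) : ℂ) / (t : ℂ)) := by
      rw [← Complex.exp_add]
      congr 1
      push_cast
      field_simp
      ring
    calc (t : ℂ) ^ (z - 1) * Complex.exp (-(t : ℂ)) * (((Real.sqrt (π / (t * c)) : ℝ) : ℂ) * Complex.exp (-((π ^ 2 * ξ ^ 2 / (t * c) : ℝ) : ℂ)))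
        = ((Real.sqrt (π / c) : ℝ) : ℂ) * (((t : ℂ) ^ (z - 1) * (t : ℂ) ^ (-(1 / 2 : ℂ))) *
            (Complex.exp (-(t : ℂ)) * Complex.exp (-((π ^ 2 * ξ ^ 2 / (t * c) : ℝ) : ℂ)))) := by rw [hsq]; ring
      _ = _ := by rw [hpow, hexp]
  -- assemble
  have hL : ∫ s : ℝ, ∫ t in Ioi (0 : ℝ), (t : ℂ) ^ (z - 1) * Complex.exp (-(((1 + c * s ^ 2 : ℝ) : ℂ) * (t : ℂ))) *
      Complex.exp (-(2 * π * Complex.I * ξ * s)) =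
      Complex.Gamma z * ∫ s : ℝ, (((1 + c * s ^ 2 : ℝ)) : ℂ) ^ (-z) * Complex.exp (-(2 * π * Complex.I * ξ * s)) := by
    simp_rw [hinner_t]
    exact integral_const_mul _ _
  have hR : ∫ t in Ioi (0 : ℝ), ∫ s : ℝ, (t : ℂ) ^ (z - 1) * Complex.exp (-(((1 + c * s ^ 2 : ℝ) : ℂ) * (t : ℂ))) *
      Complex.exp (-(2 * π * Complex.I * ξ * s)) =
      ((Real.sqrt (π / c) : ℝ) : ℂ) * ∫ t in Ioi (0 : ℝ), (t : ℂ) ^ (z - 3 / 2) * Complex.exp (-(t : ℂ) - ((π ^ 2 * ξ ^ 2 / c : ℝ) : ℂ) / (t : ℂ)) := by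
    rw [← integral_const_mul]
    exact setIntegral_congr_fun measurableSet_Ioi fun t ht => hinner_s t ht
  have key : Complex.Gamma z * ∫ s : ℝ, (((1 + c * s ^ 2 : ℝ)) : ℂ) ^ (-z) * Complex.exp (-(2 * π * Complex.I * ξ * s)) =
      ((Real.sqrt (π / c) : ℝ) : ℂ) * ∫ t in Ioi (0 : ℝ), (t : ℂ) ^ (z - 3 / 2) * Complex.exp (-(t : ℂ) - ((π ^ 2 * ξ ^ 2 / c : ℝ) : ℂ) / (t : ℂ)) := by
    rw [← hL, ← h1, h2, hR]
  set LHS := ∫ s : ℝ, (((1 + c * s ^ 2 : ℝ)) : ℂ) ^ (-z) * Complex.exp (-(2 * π * Complex.I * ξ * s)) with hLHS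
  set V := ∫ t in Ioi (0 : ℝ), (t : ℂ) ^ (z - 3 / 2) * Complex.exp (-(t : ℂ) - ((π ^ 2 * ξ ^ 2 / c : ℝ) : ℂ) / (t : ℂ)) with hV
  calc LHS = (Complex.Gamma z)⁻¹ * (Complex.Gamma z * LHS) := by rw [← mul_assoc, inv_mul_cancel₀ hΓ, one_mul]
    _ = (Complex.Gamma z)⁻¹ * (((Real.sqrt (π / c) : ℝ) : ℂ) * V) := by rw [key]
    _ = (Complex.Gamma z)⁻¹ * ((Real.sqrt (π / c) : ℝ) : ℂ) * V := (mul_assoc _ _ _).symm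

/-- §3 in Mellin currency: `∫_ℝ (1 + c s²)^{−z} e^{−2πiξs} ds = Γ(z)⁻¹·√(π∕c)·𝓜[t ↦ e^{−t−A∕t}](z − ½)`, `A = π²ξ²∕c` (`Re z > ½`, `c > 0`).
[cite: Bump1997, §1.6 (1.27)] -/
theorem integral_onePlusSqPow_mul_phase_eq_mellin {z : ℂ} (hz : 1 / 2 < z.re) {c : ℝ} (hc : 0 < c) (ξ : ℝ) :
    ∫ s : ℝ, (((1 + c * s ^ 2 : ℝ)) : ℂ) ^ (-z) * Complex.exp (-(2 * π * Complex.I * ξ * s)) =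
      (Complex.Gamma z)⁻¹ * ((Real.sqrt (π / c) : ℝ) : ℂ) *
        mellin (fun t : ℝ => Complex.exp (-(t : ℂ) - ((π ^ 2 * ξ ^ 2 / c : ℝ) : ℂ) / (t : ℂ))) (z - 1 / 2) := by
  rw [integral_onePlusSqPow_mul_phase_eq hz hc ξ, mellin]
  congr 1
  refine setIntegral_congr_fun measurableSet_Ioi fun t _ => ?_
  rw [smul_eq_mul, show z - 1 / 2 - 1 = z - 3 / 2 by ring]

/-! ## §4  The kernel `e^{−t−A∕t}`: its Mellin transform is entire for `A > 0` -/

/-- The modulus of the kernel: `‖e^{−t−A∕t}‖ = e^{−t−A∕t}` (`t, A` real). [folklore] -/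
theorem norm_expKernel (A t : ℝ) : ‖Complex.exp (-(t : ℂ) - (A : ℂ) / (t : ℂ))‖ = Real.exp (-t - A / t) := by
  rw [Complex.norm_exp, ← Complex.ofReal_div, ← Complex.ofReal_neg, ← Complex.ofReal_sub, Complex.ofReal_re]

/-- The kernel is continuous on `(0, ∞)`. [folklore] -/
theorem continuousOn_expKernel (A : ℝ) : ContinuousOn (fun t : ℝ => Complex.exp (-(t : ℂ) - (A : ℂ) / (t : ℂ))) (Ioi 0) := by
  refine fun t ht => ContinuousAt.continuousWithinAt ?_
  have ht0 : (t : ℂ) ≠ 0 := by exact_mod_cast (ne_of_gt ht)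
  exact ((Complex.continuous_ofReal.continuousAt.neg).sub (continuousAt_const.div Complex.continuous_ofReal.continuousAt ht0)).cexp

/-- At infinity the kernel is `O(e^{−t})` (`A ≥ 0`). [folklore] -/
theorem expKernel_isBigO_atTop {A : ℝ} (hA : 0 ≤ A) :
    (fun t : ℝ => Complex.exp (-(t : ℂ) - (A : ℂ) / (t : ℂ))) =O[atTop] fun t : ℝ => Real.exp (-1 * t) := by
  refine IsBigO.of_bound 1 ?_
  filter_upwards [eventually_gt_atTop 0] with t ht
  rw [norm_expKernel, one_mul, Real.norm_of_nonneg (Real.exp_pos _).le, Real.exp_le_exp]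
  have : 0 ≤ A / t := div_nonneg hA ht.le
  linarith

/-- **At `0⁺` the kernel decays faster than every power** (`A > 0`): `e^{−t−A∕t} = O(t^{−b})` as `t → 0⁺` for EVERY real `b` (substitute `u = 1∕t → ∞`:
`u^{−b}e^{−Au} → 0`, Mathlib `tendsto_rpow_mul_exp_neg_mul_atTop_nhds_zero`). [folklore] -/
theorem expKernel_isBigO_nhdsGT_zero {A : ℝ} (hA : 0 < A) (b : ℝ) :
    (fun t : ℝ => Complex.exp (-(t : ℂ) - (A : ℂ) / (t : ℂ))) =O[𝓝[>] (0 : ℝ)] fun t : ℝ => t ^ (-b) := by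
  have h1 : Tendsto (fun t : ℝ => (t⁻¹) ^ (-b) * Real.exp (-A * t⁻¹)) (𝓝[>] 0) (𝓝 0) :=
    (tendsto_rpow_mul_exp_neg_mul_atTop_nhds_zero (-b) A hA).comp tendsto_inv_nhdsGT_zero
  have h2 : ∀ᶠ t : ℝ in 𝓝[>] 0, (t⁻¹) ^ (-b) * Real.exp (-A * t⁻¹) ≤ 1 := h1.eventually (eventually_le_nhds zero_lt_one)
  refine IsBigO.of_bound 1 ?_
  filter_upwards [h2, self_mem_nhdsWithin] with t ht ht0
  rw [mem_Ioi] at ht0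
  have htb : 0 < t ^ b := Real.rpow_pos_of_pos ht0 b
  rw [Real.inv_rpow ht0.le, Real.rpow_neg ht0.le, inv_inv, mul_comm, ← le_div_iff₀ htb] at ht
  rw [norm_expKernel, one_mul, Real.norm_of_nonneg (Real.rpow_nonneg ht0.le _), Real.rpow_neg ht0.le, ← one_div]
  refine le_trans (Real.exp_le_exp.2 ?_) ht
  rw [div_eq_mul_inv A t]
  linarith

/-- **THE MELLIN TRANSFORM OF THE KERNEL IS ENTIRE** (`A > 0`): `z ↦ 𝓜[t ↦ e^{−t−A∕t}](z) = ∫_0^∞ t^{z−1} e^{−t−A∕t} dt` is differentiable on all of `ℂ`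
(exponential decay at `∞`, super-polynomial decay at `0⁺`; Mathlib `mellin_differentiableAt_of_isBigO_rpow_exp`).  Hence, by §3, for `ξ ≠ 0` the Whittaker transform
`Γ(z)·∫_ℝ (1 + c s²)^{−z} e^{−2πiξs} ds = √(π∕c)·𝓜[e^{−t−π²ξ²∕(ct)}](z − ½)`, a priori defined for `Re z > ½`, CONTINUES to an entire function of `z`.
[cite: Bump1997, §1.6, §3.7] [cite: Garrett2018, §1.10] -/
theorem differentiable_mellin_expKernel {A : ℝ} (hA : 0 < A) :
    Differentiable ℂ (mellin fun t : ℝ => Complex.exp (-(t : ℂ) - (A : ℂ) / (t : ℂ))) := fun s =>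
  mellin_differentiableAt_of_isBigO_rpow_exp one_pos ((continuousOn_expKernel A).locallyIntegrableOn measurableSet_Ioi)
    (expKernel_isBigO_atTop hA.le) (expKernel_isBigO_nhdsGT_zero hA (s.re - 1)) (by linarith)

/-! ## §5  The strip bound: exponential decay in `√A = π|ξ|∕√c` -/

/-- `t^{a−1}e^{−rt}` is integrable on `(0,∞)` for `a, r > 0` (its integral is `r^{−a}Γ(a) ≠ 0`). [folklore] -/
theorem integrableOn_rpow_mul_exp_neg_mul {a r : ℝ} (ha : 0 < a) (hr : 0 < r) :
    IntegrableOn (fun t : ℝ => t ^ (a - 1) * Real.exp (-(r * t))) (Ioi 0) := by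
  refine Integrable.of_integral_ne_zero ?_
  rw [Real.integral_rpow_mul_exp_neg_mul_Ioi ha hr]
  exact (mul_pos (Real.rpow_pos_of_pos (by positivity) _) (Real.Gamma_pos_of_pos ha)).ne'

/-- AM–GM for the kernel: `√A ≤ t∕4 + A∕t` for `t > 0`, `A ≥ 0` (`(t − 2√A)² ≥ 0`), whence `e^{−t−A∕t} ≤ e^{−3t∕4}·e^{−√A}`. [folklore] -/
theorem exp_kernel_le {A t : ℝ} (hA : 0 ≤ A) (ht : 0 < t) :
    Real.exp (-t - A / t) ≤ Real.exp (-(3 / 4 * t)) * Real.exp (-Real.sqrt A) := by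
  rw [← Real.exp_add, Real.exp_le_exp]
  set u := Real.sqrt A with hu
  have hu2 : u ^ 2 = A := Real.sq_sqrt hA
  have key : u ≤ t / 4 + A / t := by
    rw [← hu2, show t / 4 + u ^ 2 / t = (t ^ 2 + 4 * u ^ 2) / (4 * t) by rw [div_add_div _ _ (by norm_num) ht.ne']; ring,
      le_div_iff₀ (by positivity)]
    nlinarith [sq_nonneg (t - 2 * u)]
  linarith

/-- Two-sided power majorant on a strip: `t^{x−3∕2} ≤ t^{x₀−3∕2} + t^{x₁−3∕2}` for `t > 0`, `x₀ ≤ x ≤ x₁`. [folklore] -/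
theorem rpow_le_add_of_mem_Icc {t x x₀ x₁ : ℝ} (ht : 0 < t) (h₀ : x₀ ≤ x) (h₁ : x ≤ x₁) :
    t ^ (x - 3 / 2) ≤ t ^ (x₀ - 3 / 2) + t ^ (x₁ - 3 / 2) := by
  rcases le_or_gt t 1 with h | h
  · exact le_add_of_le_of_nonneg (Real.rpow_le_rpow_of_exponent_ge ht h (by linarith)) (Real.rpow_nonneg ht.le _)
  · exact le_add_of_nonneg_of_le (Real.rpow_nonneg ht.le _) (Real.rpow_le_rpow_of_exponent_le h.le (by linarith))

/-- **THE STRIP BOUND** (`A ≥ 0`, `½ < x₀ ≤ Re z ≤ x₁`):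
`‖𝓜[e^{−t−A∕t}](z − ½)‖ ≤ (∫_0^∞ (t^{x₀−3∕2} + t^{x₁−3∕2})·e^{−3t∕4} dt) · e^{−√A}` — with `A = π²ξ²∕c` this is the decay `e^{−π|ξ|∕√c}`, uniform on compacts of
`{Re z > ½}`, that rung W4 sums against divisor growth (below `Re z = ½` the bound must depend on `A`; not claimed). [cite: Bump1997, §3.7] [cite: Garrett2018, §1.10] -/
theorem norm_mellin_expKernel_le {A x₀ x₁ : ℝ} (hA : 0 ≤ A) (hx₀ : 1 / 2 < x₀) {z : ℂ} (h₀ : x₀ ≤ z.re) (h₁ : z.re ≤ x₁) :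
    ‖mellin (fun t : ℝ => Complex.exp (-(t : ℂ) - (A : ℂ) / (t : ℂ))) (z - 1 / 2)‖ ≤
      (∫ t in Ioi (0 : ℝ), (t ^ (x₀ - 3 / 2) + t ^ (x₁ - 3 / 2)) * Real.exp (-(3 / 4 * t))) * Real.exp (-Real.sqrt A) := by
  have hx₁ : 1 / 2 < x₁ := lt_of_lt_of_le hx₀ (h₀.trans h₁)
  rw [mellin, ← integral_mul_const]
  refine (norm_integral_le_integral_norm _).trans (integral_mono_of_nonneg (Eventually.of_forall fun _ => norm_nonneg _) ?_ ?_)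
  · -- the majorant is integrable
    have h0 := (integrableOn_rpow_mul_exp_neg_mul (by linarith : 0 < x₀ - 1 / 2) (by norm_num : (0 : ℝ) < 3 / 4))
    have h1 := (integrableOn_rpow_mul_exp_neg_mul (by linarith : 0 < x₁ - 1 / 2) (by norm_num : (0 : ℝ) < 3 / 4))
    refine IntegrableOn.congr_fun ((h0.add h1).mul_const (Real.exp (-Real.sqrt A))) (fun t _ => ?_) measurableSet_Ioi
    simp only [Pi.add_apply]
    rw [show x₀ - 1 / 2 - 1 = x₀ - 3 / 2 by ring, show x₁ - 1 / 2 - 1 = x₁ - 3 / 2 by ring]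
    ring
  · refine (ae_restrict_mem measurableSet_Ioi).mono fun t (ht : 0 < t) => ?_
    dsimp only
    rw [norm_smul, Complex.norm_cpow_eq_rpow_re_of_pos ht, norm_expKernel,
      show (z - 1 / 2 - 1).re = z.re - 3 / 2 by simp [Complex.sub_re]; ring]
    calc t ^ (z.re - 3 / 2) * Real.exp (-t - A / t)
        ≤ (t ^ (x₀ - 3 / 2) + t ^ (x₁ - 3 / 2)) * (Real.exp (-(3 / 4 * t)) * Real.exp (-Real.sqrt A)) :=
          mul_le_mul (rpow_le_add_of_mem_Icc ht h₀ h₁) (exp_kernel_le hA ht) (Real.exp_pos _).le (by positivity)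
      _ = (t ^ (x₀ - 3 / 2) + t ^ (x₁ - 3 / 2)) * Real.exp (-(3 / 4 * t)) * Real.exp (-Real.sqrt A) := by ring

end Summit.HodgeConjecture.HodgeConjecture.Cruxes.H413.K2E1ArchWhittakerContinuation

end
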